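import Summits.Ventures.LatticeQCDFlow.Exactness.IMHCoupledEstimatorBernsteinUnboundedWeights
import HarnessLib

/-!
# Burn-in buys the EQUILIBRIUM Bernstein bar WITHOUT A WEIGHT BOUND: `Var_{δ_xK^k} f ≤ Var_π f + 3(c − a)²(π{w > M} + ρ^k)`, hence
# `P(|H̄_R − π f| ≥ ε + (c − a)τ_k) ≤ 2·exp(−Rε²/(2(Var_π f + 3(c − a)²τ_k + (c − a)ε/3))) + R·(q{w > M} + ρ^k)`, `τ_k = π{w > M} + ρ^k`

HONEST FRAMING: exact (Metropolis-corrected) sampling algorithms for lattice gauge theory;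
figures of merit are autocorrelation/cost numbers at stated couplings and volumes; no
continuum-physics claim.

Venture `LatticeQCDFlow` (cell pub-lqcd), topic `Exactness`; FANOUT row 30 (lean-1, GEN-40).  NEW WORK of the cell, general
(standard Borel) state space, EVERY proposal law `q`, EVERY positive normalised weight — no bound on `w`, no moment condition.
GEN-40's `Exactness/IMHCoupledEstimatorBernstein` showed under a BOUNDED weight that the read-out variance after `n` updates is an
equilibrium quantity, `Var_{μ₀Kⁿ} f ≤ Var_π f + 3rⁿ(c − a)²`; `Exactness/IMHCoupledEstimatorBernsteinUnboundedWeights` proved the Bernstein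
bar without a weight bound but with the variance `σ² ≥ Var_{δ_xK^k} f` as an INPUT.  Here the input is discharged for every weight:

* §1 **`variance_iterate_bind_indepMH_dirac_le_tail`** — for `a ≤ f ≤ c` measurable, every `x`, `k`, `M`:
  `Var_{δ_xK^k} f ≤ Var_π f + 3(c − a)²·(π{M < w} + (1 − c₁/max(1, w(x), M))^k)` (`c₁ = E_q[min(1, w)]`; second moment and mean of
  `f − a` are each within range·GEN-40's every-start observable rate of their equilibrium values).
* §2 **`crnLag_replicas_burnIn_bernstein_abs_target_equilibrium_everyWeight`** — production run at `x` with `w(x) ≤ M`, leading run one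
  update ahead, `R` independent coupled pairs, window `N`, burn-in `k`, `τ = π{M < w} + ρ^k`, `ρ = 1 − c₁/max(1, M)`,
  `Var_π f + 3(c − a)²τ > 0`, `ε ≥ 0`, `R ≥ 1`:
  `P(|H̄_R − π f| ≥ ε + (c − a)τ) ≤ 2·exp(−Rε²/(2(Var_π f + 3(c − a)²τ + (c − a)ε/3))) + R·(q{M < w} + ρ^k)` —
  THE BERNSTEIN BAR OF `R` INDEPENDENT EQUILIBRIUM MEASUREMENTS AT THE OBSERVABLE'S EQUILIBRIUM VARIANCE, for every flow, up to terms
  that vanish as `k → ∞` and then `M → ∞`.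
Reading (gauge files): for coupled pairs of two exact gauge samplers on one stream of random numbers, the certified error bar of the
burn-in-free average is the equilibrium Bernstein bar — the VARIANCE of the observable per `ε²`, not its squared range — for EVERY flow,
however heavy the tails of its weight.
NOT CLAIMED: a rate in `k` uniform in the flow (there is none without a weight bound); anything for unbounded `f`.  No `sorry`, no new
definitions, nothing cited as a fact.
-/

noncomputable section

namespace Summit.Ventures.LatticeQCDFlow.Exactness

open MeasureTheory ProbabilityTheory Function Finset Filter
open scoped _root_.ENNReal unitInterval Topology
open Summit.Ventures.LatticeQCDFlow.Scoring

variable {Ω : Type*} [MeasurableSpace Ω] {q : Measure Ω} [IsProbabilityMeasure q] {w : Ω → ℝ}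

/-! ## §1 The read-out variance after the burn-in is an equilibrium quantity — every weight -/

/-- **`Var_{δ_xK^k} f ≤ Var_π f + 3(c − a)²(π{M < w} + (1 − c₁/max(1, w(x), M))^k)`** for `a ≤ f ≤ c` measurable, every `x`, `k`, `M`
(standard Borel `Ω`, every positive normalised weight). [ours] -/
theorem variance_iterate_bind_indepMH_dirac_le_tail [StandardBorelSpace Ω] [Nonempty Ω] [MeasurableSingletonClass Ω] [MeasurableEq Ω]
    (hw : Measurable w) (hw0 : ∀ y, 0 < w y) [IsProbabilityMeasure (q.withDensity fun y => ENNReal.ofReal (w y))]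
    (x : Ω) {f : Ω → ℝ} (hf : Measurable f) {a c : ℝ} (ha : ∀ y, a ≤ f y) (hc : ∀ y, f y ≤ c) (k : ℕ) (M : ℝ) :
    variance f ((fun m : Measure Ω => m.bind (indepMH q w))^[k] (Measure.dirac x)) ≤
      variance f (q.withDensity fun y => ENNReal.ofReal (w y)) +
        3 * ((c - a) ^ 2 * ((q.withDensity fun y => ENNReal.ofReal (w y)) {y | M < w y} +
          (1 - (∫⁻ u, ENNReal.ofReal (min 1 (w u)) ∂q) / ENNReal.ofReal (max 1 (max (w x) M))) ^ k).toReal) := by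
  haveI : Fact (Measurable w) := ⟨hw⟩
  haveI := isProbabilityMeasure_iterate_bind (κ := indepMH q w) (Measure.dirac x) k
  set μn : Measure Ω := (fun m : Measure Ω => m.bind (indepMH q w))^[k] (Measure.dirac x) with hμn
  set π : Measure Ω := q.withDensity fun y => ENNReal.ofReal (w y) with hπ
  set τ : ℝ := (π {y | M < w y} +
    (1 - (∫⁻ u, ENNReal.ofReal (min 1 (w u)) ∂q) / ENNReal.ofReal (max 1 (max (w x) M))) ^ k).toReal with hτ
  have hτ0 : 0 ≤ τ := ENNReal.toReal_nonneg
  set g : Ω → ℝ := fun y => f y - a with hg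
  have hg0 : ∀ y, 0 ≤ g y := fun y => sub_nonneg.2 (ha y)
  have hgc : ∀ y, g y ≤ c - a := fun y => sub_le_sub_right (hc y) a
  have hgm : Measurable g := hf.sub_const a
  have hg2m : Measurable fun y => g y ^ 2 := hgm.pow_const 2
  have hg20 : ∀ y, 0 ≤ g y ^ 2 := fun y => sq_nonneg _
  have hg2c : ∀ y, g y ^ 2 ≤ (c - a) ^ 2 := fun y => pow_le_pow_left₀ (hg0 y) (hgc y) 2
  have hvar : ∀ (m : Measure Ω) [IsProbabilityMeasure m], variance f m = variance g m := fun m _ => by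
    rw [hg, variance_sub_const hf.aestronglyMeasurable]
  have hvg : ∀ (m : Measure Ω) [IsProbabilityMeasure m], variance g m = ∫ y, g y ^ 2 ∂m - (∫ y, g y ∂m) ^ 2 :=
    fun m _ => by
    rw [variance_eq_sub (memLp_of_bounded (a := 0) (b := c - a) (ae_of_all _ fun y => ⟨hg0 y, hgc y⟩)
      hgm.aestronglyMeasurable 2)]
    rfl
  have hmean_le : ∀ (m : Measure Ω) [IsProbabilityMeasure m], 0 ≤ ∫ y, g y ∂m ∧ ∫ y, g y ∂m ≤ c - a := fun m _ => by
    refine ⟨integral_nonneg hg0, ?_⟩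
    calc ∫ y, g y ∂m ≤ ∫ _, (c - a) ∂m :=
          integral_mono_of_nonneg (ae_of_all _ hg0) (integrable_const _) (ae_of_all _ hgc)
      _ = c - a := by simp
  -- GEN-40's every-start observable rate, for `g²` and for `g`
  have h1 : |∫ y, g y ^ 2 ∂π - ∫ y, g y ^ 2 ∂μn| ≤ ((c - a) ^ 2 - 0) * τ :=
    imh_everyStart_integral_sub_abs_le_tail (q := q) hw hw0 x hg2m hg20 hg2c k M
  have h2 : |∫ y, g y ∂π - ∫ y, g y ∂μn| ≤ ((c - a) - 0) * τ :=
    imh_everyStart_integral_sub_abs_le_tail (q := q) hw hw0 x hgm hg0 hgc k M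
  rw [sub_zero] at h1 h2
  rw [hvar μn, hvar π, hvg μn, hvg π]
  set A := ∫ y, g y ∂μn with hA
  set B := ∫ y, g y ∂π with hB
  obtain ⟨hA0, hAc⟩ := hmean_le μn
  obtain ⟨hB0, hBc⟩ := hmean_le π
  have e1 : ∫ y, g y ^ 2 ∂μn - ∫ y, g y ^ 2 ∂π ≤ (c - a) ^ 2 * τ := (abs_sub_le_iff.1 h1).2
  have hδ0 : 0 ≤ (c - a) * τ := (abs_nonneg _).trans h2
  have e2 : B - A ≤ (c - a) * τ := (abs_sub_le_iff.1 h2).1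
  have e3 : B ^ 2 - A ^ 2 ≤ (c - a) * τ * (2 * (c - a)) :=
    calc B ^ 2 - A ^ 2 = (B - A) * (A + B) := by ring
      _ ≤ (c - a) * τ * (A + B) := mul_le_mul_of_nonneg_right e2 (by linarith)
      _ ≤ (c - a) * τ * (2 * (c - a)) := mul_le_mul_of_nonneg_left (by linarith) hδ0
  nlinarith

section Replicas

variable {Ω' : Type*} {mΩ' : MeasurableSpace Ω'} {μ : Measure Ω'} [IsProbabilityMeasure μ]
  {Z : ℕ → Ω' → (ℕ → Ω × Ω)}

/-! ## §2 The equilibrium Bernstein bar from the practical start, every weight -/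

/-- **BURN-IN BUYS THE EQUILIBRIUM BERNSTEIN BAR — EVERY WEIGHT, EVERY PROPOSAL LAW**: standard Borel `Ω`; production run at `x` with
`w(x) ≤ M`, leading run one update ahead (`ν̂_x = K(x, ·)∘(y ↦ (y, x))⁻¹`), `R` independent coupled pairs, window `N`, burn-in `k`,
`τ = π{M < w} + ρ^k`, `ρ = 1 − c₁/max(1, M)`, `Var_π f + 3(c − a)²τ > 0`, `ε ≥ 0`, `R ≥ 1`:
`P(|H̄_R − π f| ≥ ε + (c − a)τ) ≤ 2·exp(−Rε²/(2(Var_π f + 3(c − a)²τ + (c − a)ε/3))) + R·(q{M < w} + ρ^k)`. [ours] -/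
theorem crnLag_replicas_burnIn_bernstein_abs_target_equilibrium_everyWeight [StandardBorelSpace Ω] [Nonempty Ω]
    [MeasurableSingletonClass Ω] [MeasurableEq Ω] [Fact (Measurable w)] (hw0 : ∀ y, 0 < w y)
    [IsProbabilityMeasure (q.withDensity fun y => ENNReal.ofReal (w y))]
    (Khat : Kernel (Ω × Ω) (Ω × Ω)) [IsMarkovKernel Khat]
    (hK : ∀ z : Ω × Ω, Khat z = (q.prod (volume : Measure unitInterval)).map (fun p : Ω × unitInterval =>
      ((if (p.2 : ℝ) * w z.1 ≤ w p.1 then p.1 else z.1), (if (p.2 : ℝ) * w z.2 ≤ w p.1 then p.1 else z.2))))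
    (x : Ω) {M : ℝ} (hxM : w x ≤ M) (ν : Measure (Ω × Ω)) [IsProbabilityMeasure ν]
    (hν : ν = (indepMH q w x).map fun y : Ω => (y, x)) {f : Ω → ℝ} (hf : Measurable f) {a c : ℝ} (ha : ∀ y, a ≤ f y)
    (hc : ∀ y, f y ≤ c) (k N : ℕ) (hZm : ∀ j, Measurable (Z j))
    (hlaw : ∀ j, μ.map (Z j) = Kernel.trajMeasure (X := fun _ : ℕ => Ω × Ω) ν
      (fun n : ℕ => Khat.comap (fun h : (i : ↥(Finset.Iic n)) → Ω × Ω => h ⟨n, Finset.mem_Iic.2 le_rfl⟩)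
        (measurable_pi_apply _)))
    (hind : iIndepFun Z μ)
    (hσ : 0 < variance f (q.withDensity fun y => ENNReal.ofReal (w y)) +
      3 * ((c - a) ^ 2 * ((q.withDensity fun y => ENNReal.ofReal (w y)) {y | M < w y} +
        (1 - (∫⁻ u, ENNReal.ofReal (min 1 (w u)) ∂q) / ENNReal.ofReal (max 1 M)) ^ k).toReal))
    {ε : ℝ} (hε : 0 ≤ ε) {R : ℕ} (hR : 1 ≤ R) :
    μ.real {ω | ε + (c - a) * ((q.withDensity fun y => ENNReal.ofReal (w y)) {y | M < w y} +
          (1 - (∫⁻ u, ENNReal.ofReal (min 1 (w u)) ∂q) / ENNReal.ofReal (max 1 M)) ^ k).toReal ≤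
        |(R : ℝ)⁻¹ * ∑ j ∈ range R, (f ((Z j ω k).2) + ∑ n ∈ range N, (f ((Z j ω (k + n)).1) - f ((Z j ω (k + n)).2))) -
          ∫ y, f y ∂(q.withDensity fun y => ENNReal.ofReal (w y))|} ≤
      2 * Real.exp (-(R * ε ^ 2) / (2 * (variance f (q.withDensity fun y => ENNReal.ofReal (w y)) +
          3 * ((c - a) ^ 2 * ((q.withDensity fun y => ENNReal.ofReal (w y)) {y | M < w y} +
            (1 - (∫⁻ u, ENNReal.ofReal (min 1 (w u)) ∂q) / ENNReal.ofReal (max 1 M)) ^ k).toReal) + (c - a) * ε / 3))) +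
        R * (q {y | M < w y} + (1 - (∫⁻ u, ENNReal.ofReal (min 1 (w u)) ∂q) / ENNReal.ofReal (max 1 M)) ^ k).toReal := by
  have hw : Measurable w := Fact.out
  have hσk := variance_iterate_bind_indepMH_dirac_le_tail (q := q) hw hw0 x hf ha hc k M
  rw [max_eq_right hxM] at hσk
  exact crnLag_replicas_burnIn_bernstein_abs_target_everyWeight hw0 Khat hK x hxM ν hν hf ha hc k N hZm hlaw hind hσ hσk hε hR

end Replicas

end Summit.Ventures.LatticeQCDFlow.Exactness

end
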